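import Summits.QuantumFields.YangMills.Theses.SamplerStability
import Summits.QuantumFields.YangMills.Theorems.SamplerStabilityStabilityKernelGlue
import Summits.QuantumFields.YangMills.Theorems.SamplerStabilityGapRateToWaist
import Summits.QuantumFields.YangMills.Theorems.SamplerStabilityWaistToLeaf
import HarnessLib

/-!
# Route `SamplerStability`, item `StabilityKernel` (stmt-QuantumFields-28043) — the derived split theorem, materialised

`SamplerStability.StabilityKernel` was closed BY SPLIT: children `GapRateToWaist` (stmt-QuantumFields-28102,
`SamplerStabilityWaist.gapRateToWaist_proof`) and `WaistToLeaf` (stmt-QuantumFields-28103, `SamplerStabilityWaist.waistToLeaf_proof`),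
glue `StabilityKernelGlue : GapRateToWaist → WaistToLeaf → StabilityKernel` (stmt-QuantumFields-28104,
`samplerStability_stabilityKernelGlue_proof`).  All three are landed and kernel-checked; this file records the composition so that
the item closes on a declaration that resolves (ledger BY-SPLIT sweep 2026-08-30, director-ym R569-ym (2)).

HONEST FRAMING: `StabilityKernel` is the REDUCTION `UnitSamplerGap ∧ SpecificationRate ⇒ ContinuumYM3Torus …` (pure measure theory:
Poincaré at `√h_K`, Le Cam, Cauchy summability); the route's cruxes `UnitSamplerGap` / `SpecificationRate` stay open; rung R3 is a
RECORD rung; the Yang–Mills mass gap is NOT proved.  No `sorry`, no new axiom, no new definition.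
-/

set_option autoImplicit false

namespace Summit.QuantumFields.YangMills.Theorems

/-- ★ **`SamplerStability.StabilityKernel` holds** (item stmt-QuantumFields-28043, BY NAME): the glue
`samplerStability_stabilityKernelGlue_proof` applied to the two landed children `gapRateToWaist_proof` and `waistToLeaf_proof`.
The Yang–Mills mass gap is NOT proved. -/
theorem samplerStability_stabilityKernel_proof :
    Summit.QuantumFields.YangMills.Theses.SamplerStability.StabilityKernel :=
  samplerStability_stabilityKernelGlue_proof
    Summit.QuantumFields.YangMills.Theorems.SamplerStabilityWaist.gapRateToWaist_proof
    Summit.QuantumFields.YangMills.Theorems.SamplerStabilityWaist.waistToLeaf_proof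

end Summit.QuantumFields.YangMills.Theorems
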